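import Summits.QuantumFields.YangMills.Theorems.UnitScaleTiltProp7SectET3BgClass
import Literature.MathematicalPhysics.QuantumFieldTheory.Balaban1983to89.B9Thm313Whole
import HarnessLib

/-!
# Route `UnitScaleTilt`, crux «MinimiserStabilityRegPr» (stmt-QuantumFields-19200, v10 stub EX `stub_existenceMinimalOrbit`, route (α), node N06(d = 3)) — OWNER RULING g25-№2,
# item (N06-3-4) / layer (S3-b): **THE TWO N06 LEAVES `B9.Thm312Printed` ∕ `B9.Thm313Printed` AT THE T³ INDEX FROM THEIR DISPLAYED OBLIGATIONS — Track A's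
# `N06AtRecord11ObligationsPins3.t312_of_pins ∕ t313_of_pins` READ AT d + 1 = 3, geometry `geo9K`, backgrounds `bgT3`, the geometry rows DISCHARGED by ★w3's file**

Cell `ym3-torus` (HUMAN RULING D-0037, YM ladder rung R3 — NOT the Clay problem), width seat ym-ust-20520-w1 g2 (re-pointed (S2-bg) → (N06-3-4), OWNER g25 W-SEAT MAP #5).
Count-neutral helper (`--supports stmt-QuantumFields-19200 --as helper`); registry untouched; NOTHING of [Balaban1985BackgroundPropagators] is asserted.

WHAT.  The N06(d = 3) node of R3's EX (RULING g25-№2 §1: `B9.Thm313Printed c35 geo bg GG …` ∧ `B9.Thm312Printed …` at the T³ member index, `geo := geo9K`, `bg :=` the SU(2)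
(14)-class carrier) is read here EXACTLY the way Track A reads it at the T⁴ record (`N06AtRecord11ObligationsPins3`, θ₃.d₆): from seat n06-l's generic leaves
`B9Thm312WholeLeaf.thm312Printed_of_step` ∕ `B9Thm313Whole.thm313Printed_of_step` at the index `I := KIdx 2 ℓ hd3 hL b₀ b₁` (def-Y's k-level V1 index at d + 1 = 3; ★w3-20520 g2's
`memberIdx` lands in it at `b₀ = b₁ = 1`), `geo := B9GeoNormsKLevelV1.geo9K`, `bg := Prop7SectET3BgClass.bgT3` (= `bg9K M₂(ℂ) SU(2)ˣ`, p596981), with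
* the GEOMETRY rows DISCHARGED — `GeoOK` (★w3's `Prop7SectET3Geometry.geoOK_geo9K`, p595877), the model signs (`modelSignsOn_geo9K`), the row sum (2.61) at every rate
  `σ > 0` (`rowSum261_geo9K`, constant floored at `0`);
* the OPERATOR-side obligations DISPLAYED VERBATIM as binders over one letter record `𝔬 i : B9Thm312Whole.Ops (geo9K i) (bgT3 i) …` per member: the co-readings `hco`, the
  model hypotheses `hmodel` = {(N06-3-1) `Thm33G0` (Thm 3.3 for `G₀(U)` at curved U — THE XL ITEM), (N06-3-2) the two `Step`s (3.131)∕(3.138), (N06-3-3) `FormSmall`, (N06-3-5)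
  `Identities`}, **(N06-3-4) `hletters`** = the (3.132)∕(3.126) coarse letters `Letters313 (𝔬 i) (R₀ i) (H₀ i) (geoOK_geo9K i) B₃ δ₃ U` (ten `HasMaj` rows for `G₀∘D_v`,
  `G₀∘Q*`, `R∘D_v*∘G₁(∘∇*)`, `C₁ = (QG₁Q*)⁻¹`, `Q` between the block classes; inhabited in the tree ONLY at U = 1, by the d-generic KIdx-uniform `B9Letters313AtOne{Dv,Q}` ∕
  `B9LettersH{,Z}AtOne*` theorems, which instantiate at this index with `d := 2` verbatim), the residual `hres`, and the predicate pins.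
So: `t312_of_pins_T3` ∕ `t313_of_pins_T3` : (displayed N06(d = 3) obligations at the T³ index) → the two leaf statements VERBATIM — the objects (S3-b)'s knit
`normG_normH₁_of_N06d3Obligations` (★w4-19200 g0) reads `norm_G` ∕ `norm_H₁` from through `Thm313Printed`'s global clause (★w2-20520 g2's `Space115 ↔ wNorm` dictionary,
p596275) — here in the `_of_step` species; the `_completePairMBZ` species (co-reading proved, more letters: `Letters313Z∕DZ∕DMZ∕HZ`) is the same port with more binders.
HONEST SCOPE: kernel bookkeeping at d := 2 of LANDED generic theorems; every analytic row stays a hypothesis; N06(d = 3) is NOT discharged; nothing here claims EX, the crux,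
V3∕R3, d = 4 or the mass gap.

References: T. Bałaban, CMP **99** (1985) 389–434 [Balaban1985BackgroundPropagators] (Thm 3.3 p.399, Thm 3.11 p.416, (3.126) p.420, (3.130)–(3.138) pp.421–423, Thm 3.12
p.423, (3.132) p.422, (3.147)–(3.153) pp.425–426, Thm 3.13 p.426); CMP **96** (1984) 223–250 [Balaban1984PropagatorsII] (Lemma 2.1 (2.60)–(2.61) p.234).
-/

set_option autoImplicit false

noncomputable section

open scoped Matrix.Norms.L2Operator

namespace Summit.QuantumFields.YangMills.Theorems.Prop7SectET3N06Leaves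

open Literature.MathematicalPhysics.QuantumFieldTheory.Balaban1983to89
open Literature.MathematicalPhysics.QuantumFieldTheory.Balaban1983to89.B6KLevelCensusIndexV1 (KIdx)
open Literature.MathematicalPhysics.QuantumFieldTheory.Balaban1983to89.B9GeoNormsKLevelV1 (geo9K)
open Literature.MathematicalPhysics.QuantumFieldTheory.Balaban1983to89.B9Thm34Ext (toB6)
open Literature.MathematicalPhysics.QuantumFieldTheory.Balaban1983to89.B11SectG (RowSum)
open Literature.MathematicalPhysics.QuantumFieldTheory.Balaban1983to89.B9Thm37GlueCor36 (CoRealizes Clause342)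
open Literature.MathematicalPhysics.QuantumFieldTheory.Balaban1983to89.B9FromB6 (L2Block)
open Literature.MathematicalPhysics.QuantumFieldTheory.Balaban1983to89.B9Thm312Whole
  (Ops GeoOK Thm33G0 Step FormSmall Identities HasRWExpOfOps HasRWExpHOfOps PosDefKOfOps)
open Literature.MathematicalPhysics.QuantumFieldTheory.Balaban1983to89.B9Thm312WholeLeaf (thm312Printed_of_step)
open Literature.MathematicalPhysics.QuantumFieldTheory.Balaban1983to89.B9Thm313Whole (Letters313 thm313Printed_of_step)
open Literature.MathematicalPhysics.QuantumFieldTheory.Balaban1983to89.B9GeoLemma21KLevelV1 (rowSum261_geo9K)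
open Literature.MathematicalPhysics.QuantumFieldTheory.Balaban1983to89.B9GeoNormsKLevelModelSignsV1 (modelSignsOn_geo9K)
open Summit.QuantumFields.YangMills.Theorems.Prop7SectET3Members (hd3)
open Summit.QuantumFields.YangMills.Theorems.Prop7SectET3Geometry (geoOK_geo9K)
open Summit.QuantumFields.YangMills.Theorems.Prop7SectET3BgClass (bgT3)

variable {ℓ : ℕ} {hL : Odd (ℓ + 1) ∧ 1 < ℓ + 1} {b₀ b₁ : ℝ}

/-- ★ **THEOREM 3.12's LEAF AT THE T³ INDEX FROM ITS DISPLAYED OBLIGATIONS** (Track A's `t312_of_pins` at d + 1 = 3): at `I := KIdx 2 ℓ hd3 hL b₀ b₁`, `geo := geo9K`, `bg := bgT3`,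
the co-readings `hco` of the two kernel families `GD`, `G₁` by the letters `G`, `G₁` (n = 0, 2), the model hypotheses `hmodel` (Thm 3.3 for `G₀`, the (3.131)∕(3.138) steps with
`θ = θ₁·Mα₀`, the form smallness with `r = r₁·Mα₀`, the identities — under `M ≥ M₁`, `0 < α₀`, `Mα₀ ≤ a₁`, (3.35), (3.36)), the displayed residual `hres` of the two kernel families
and the two H-kernels, and the three predicate pins give `B9.Thm312Printed 3 c35 geo9K bgT3 GD G₁ Hk H₁k HasRWExp HasRWExpH PosDefK`.  DISCHARGED here: `GeoOK` (`geoOK_geo9K`),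
the model signs (`modelSignsOn_geo9K`), the row sum (2.61) at rate `σ > 0` (`rowSum261_geo9K`, constant floored at 0).
[cite: Balaban1985BackgroundPropagators, Thm 3.12 (3.130)-(3.138) pp.421-423, Thm 3.3 p.399; Balaban1984PropagatorsII, Lemma 2.1 (2.61) p.234] -/
theorem t312_of_pins_T3 [∀ i : KIdx 2 ℓ hd3 hL b₀ b₁, Fintype (geo9K i).Site]
    {X Y Z W : KIdx 2 ℓ hd3 hL b₀ b₁ → Type} [∀ i, Fintype (X i)] [∀ i, DecidableEq (X i)] [∀ i, Fintype (Y i)] [∀ i, Fintype (Z i)] [∀ i, Fintype (W i)]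
    (𝔬 : ∀ i : KIdx 2 ℓ hd3 hL b₀ b₁, Ops (geo9K i) (bgT3 i) (X i) (Y i) (Z i) (W i)) (R₀ : KIdx 2 ℓ hd3 hL b₀ b₁ → ℝ) (H₀ : KIdx 2 ℓ hd3 hL b₀ b₁ → Prop)
    (GD G₁ : ∀ i : KIdx 2 ℓ hd3 hL b₀ b₁, B9.KernelFamily (geo9K i) (bgT3 i)) (Hk H₁k : ∀ i : KIdx 2 ℓ hd3 hL b₀ b₁, B9.HKernel (geo9K i) (bgT3 i))
    (HasRWExp : ∀ i : KIdx 2 ℓ hd3 hL b₀ b₁, B9.KernelFamily (geo9K i) (bgT3 i) → (bgT3 i).Cfg → ℝ → Prop)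
    (HasRWExpH : ∀ i : KIdx 2 ℓ hd3 hL b₀ b₁, B9.HKernel (geo9K i) (bgT3 i) → (bgT3 i).Cfg → ℝ → Prop)
    (PosDefK : ∀ i : KIdx 2 ℓ hd3 hL b₀ b₁, B9.KernelFamily (geo9K i) (bgT3 i) → (bgT3 i).Cfg → Prop)
    (ev : ∀ i : KIdx 2 ℓ hd3 hL b₀ b₁, (geo9K i).Loc → X i → ℝ) (evY : ∀ i : KIdx 2 ℓ hd3 hL b₀ b₁, (geo9K i).Loc → Y i → ℝ)
    (c35 θ₁ r₁ B₀ δ₀ δK σ ρ a₁ M₁ B₁ δ₁ : ℝ) (Bβ Bε : ℝ → ℝ) (Bεβ : ℝ → ℝ → ℝ)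
    (hθ₁ : 0 ≤ θ₁) (hr₁ : 0 ≤ r₁) (hB₀ : 0 ≤ B₀) (hρ : 0 < ρ) (hρS : ρ ≤ δ₀) (hρδ : ρ + σ ≤ δK) (hσ : 0 < σ)
    (ha₁ : 0 < a₁) (hM₁ : 0 < M₁) (hB₁ : 0 ≤ B₁) (hδ₁ : 0 < δ₁) (hBβ : ∀ β, 0 ≤ Bβ β) (hBε : ∀ ε, 0 ≤ Bε ε) (hBεβ : ∀ ε β, 0 ≤ Bεβ ε β)
    (hco : ∀ (i : KIdx 2 ℓ hd3 hL b₀ b₁) (U : (bgT3 i).Cfg),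
      CoRealizes (GD i) 0 U (𝔬 i).blk (𝔬 i).blk (ev i) ((𝔬 i).G U) ∧
      CoRealizes (GD i) 2 U (𝔬 i).blk (𝔬 i).blkY (evY i) ((𝔬 i).G U ∘ₗ (𝔬 i).Dstar U) ∧
      CoRealizes (G₁ i) 0 U (𝔬 i).blk (𝔬 i).blk (ev i) ((𝔬 i).G1 U) ∧
      CoRealizes (G₁ i) 2 U (𝔬 i).blk (𝔬 i).blkY (evY i) ((𝔬 i).G1 U ∘ₗ (𝔬 i).Dstar U))
    (hmodel : ∀ i : KIdx 2 ℓ hd3 hL b₀ b₁, M₁ ≤ (geo9K i).M → ∀ α₀ : ℝ, 0 < α₀ → (geo9K i).M * α₀ ≤ a₁ →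
      ∀ U : (bgT3 i).Cfg, (bgT3 i).Reg335 c35 α₀ U → (bgT3 i).Reg336 c35 α₀ U →
        Thm33G0 (𝔬 i) (R₀ i) (H₀ i) B₀ δ₀ U ∧
        Step (𝔬 i) (R₀ i) (H₀ i) (geoOK_geo9K i).lenle 1 (θ₁ * ((geo9K i).M * α₀)) δK U ∧
        Step (𝔬 i) (R₀ i) (H₀ i) (geoOK_geo9K i).lenle 2 (θ₁ * ((geo9K i).M * α₀)) δK U ∧
        FormSmall (𝔬 i) (r₁ * ((geo9K i).M * α₀)) U ∧ Identities (𝔬 i) U)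
    (hres : ∀ i : KIdx 2 ℓ hd3 hL b₀ b₁, M₁ ≤ (geo9K i).M → ∀ α₀ : ℝ, 0 < α₀ → (geo9K i).M * α₀ ≤ a₁ →
      ∀ U : (bgT3 i).Cfg, (bgT3 i).Reg335 c35 α₀ U → (bgT3 i).Reg336 c35 α₀ U →
        (∀ K ∈ [GD i, G₁ i], Clause342 K 1 B₁ δ₁ U ∧ L2Block K B₁ δ₁ U ∧
          (∀ (n : Fin 4) (lam : (geo9K i).Loc) (γ : ℝ), n ≠ 3 → -4 ≤ γ → γ ≤ 4 →
            K.glob n U lam γ ≤ B₁ * (geo9K i).wNorm γ lam) ∧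
          B9.Ineq343_345 K Bβ Bε Bεβ δ₁ U) ∧
        (∀ Hk' ∈ [Hk i, H₁k i], B9.Ineq3133 (2 + 1) Hk' B₁ Bβ δ₁ U))
    (hpinE : ∀ i : KIdx 2 ℓ hd3 hL b₀ b₁, HasRWExp i = HasRWExpOfOps (𝔬 i)) (hpinH : ∀ i : KIdx 2 ℓ hd3 hL b₀ b₁, HasRWExpH i = HasRWExpHOfOps (𝔬 i))
    (hpinK : ∀ i : KIdx 2 ℓ hd3 hL b₀ b₁, PosDefK i = PosDefKOfOps (𝔬 i)) :
    B9.Thm312Printed (2 + 1) c35 geo9K bgT3 GD G₁ Hk H₁k HasRWExp HasRWExpH PosDefK := by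
  have hE : HasRWExp = fun i => HasRWExpOfOps (𝔬 i) := funext hpinE
  have hH : HasRWExpH = fun i => HasRWExpHOfOps (𝔬 i) := funext hpinH
  have hK : PosDefK = fun i => PosDefKOfOps (𝔬 i) := funext hpinK
  rw [hE, hH, hK]
  obtain ⟨ML, c, hrow⟩ := rowSum261_geo9K (d := 2) (ℓ := ℓ) (hd := hd3) (hL := hL) (b₀ := b₀) (b₁ := b₁) σ hσ
  exact thm312Printed_of_step 𝔬 R₀ H₀ GD G₁ Hk H₁k ev evY θ₁ r₁ B₀ δ₀ δK σ (max c 0) ρ a₁ M₁ ML B₁ δ₁ Bβ Bε Bεβ hθ₁ hr₁ hB₀ hρ hρS hρδ (le_max_right _ _)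
    ha₁ hM₁ hB₁ hδ₁ hBβ hBε hBεβ (fun i => geoOK_geo9K i) (fun i => modelSignsOn_geo9K i) (fun i hM y => (hrow i hM y).trans (le_max_left _ _)) hco hmodel hres

/-- ★ **THEOREM 3.13's LEAF AT THE T³ INDEX FROM ITS DISPLAYED OBLIGATIONS** (Track A's `t313_of_pins` at d + 1 = 3): the SAME letter record `𝔬` and model hypotheses `hmodel` as
Thm 3.12's, the co-readings of the free kernel family `GG` (n = 0, 2), **(N06-3-4) the ten printed-shape letters `Letters313` of the (3.147)∕(3.153) reduction** (displayed:
`hletters`), the displayed residual of 𝔊 ((3.42)₂, L², (3.47)ₙ≠₃, (3.43)–(3.45)) and the two predicate pins give `B9.Thm313Printed c35 geo9K bgT3 GG HasRWExp PosDefK` — the N06(d = 3)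
leaf statement VERBATIM at the T³ index.  DISCHARGED here: `GeoOK`, the model signs, the generic row sum at the rate `σ > 0` (constant floored at 0).
[cite: Balaban1985BackgroundPropagators, Thm 3.13 (3.150)-(3.153) pp.424-426, (3.132) p.422, Thm 3.12 pp.421-423; Balaban1984PropagatorsII, Lemma 2.1 (2.61) p.234] -/
theorem t313_of_pins_T3 [∀ i : KIdx 2 ℓ hd3 hL b₀ b₁, Fintype (geo9K i).Site]
    {X Y Z W : KIdx 2 ℓ hd3 hL b₀ b₁ → Type} [∀ i, Fintype (X i)] [∀ i, DecidableEq (X i)] [∀ i, Fintype (Y i)] [∀ i, Fintype (Z i)] [∀ i, Fintype (W i)]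
    (𝔬 : ∀ i : KIdx 2 ℓ hd3 hL b₀ b₁, Ops (geo9K i) (bgT3 i) (X i) (Y i) (Z i) (W i)) (R₀ : KIdx 2 ℓ hd3 hL b₀ b₁ → ℝ) (H₀ : KIdx 2 ℓ hd3 hL b₀ b₁ → Prop)
    (GG : ∀ i : KIdx 2 ℓ hd3 hL b₀ b₁, B9.KernelFamily (geo9K i) (bgT3 i))
    (HasRWExp : ∀ i : KIdx 2 ℓ hd3 hL b₀ b₁, B9.KernelFamily (geo9K i) (bgT3 i) → (bgT3 i).Cfg → ℝ → Prop)
    (PosDefK : ∀ i : KIdx 2 ℓ hd3 hL b₀ b₁, B9.KernelFamily (geo9K i) (bgT3 i) → (bgT3 i).Cfg → Prop)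
    (ev : ∀ i : KIdx 2 ℓ hd3 hL b₀ b₁, (geo9K i).Loc → X i → ℝ) (evY : ∀ i : KIdx 2 ℓ hd3 hL b₀ b₁, (geo9K i).Loc → Y i → ℝ)
    (c35 θ₁ r₁ B₀ δ₀ δK σ ρ a₁ M₁ B₁ δ₁ B₃ δ₃ ρ' : ℝ) (Bβ Bε : ℝ → ℝ) (Bεβ : ℝ → ℝ → ℝ)
    (hθ₁ : 0 ≤ θ₁) (hr₁ : 0 ≤ r₁) (hB₀ : 0 ≤ B₀) (hB₃ : 0 ≤ B₃) (hσ : 0 < σ) (hρ' : 0 < ρ') (hρ'ρ : ρ' + 3 * σ ≤ ρ) (hρS : ρ ≤ δ₀) (hρ₃ : ρ ≤ δ₃)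
    (hρδ : ρ + σ ≤ δK) (ha₁ : 0 < a₁) (hM₁ : 0 < M₁) (hB₁ : 0 ≤ B₁) (hδ₁ : 0 < δ₁) (hBβ : ∀ β, 0 ≤ Bβ β) (hBε : ∀ ε, 0 ≤ Bε ε) (hBεβ : ∀ ε β, 0 ≤ Bεβ ε β)
    (hco : ∀ (i : KIdx 2 ℓ hd3 hL b₀ b₁) (U : (bgT3 i).Cfg),
      CoRealizes (GG i) 0 U (𝔬 i).blk (𝔬 i).blk (ev i) ((𝔬 i).GG U) ∧
      CoRealizes (GG i) 2 U (𝔬 i).blk (𝔬 i).blkY (evY i) ((𝔬 i).GG U ∘ₗ (𝔬 i).Dstar U))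
    (hmodel : ∀ i : KIdx 2 ℓ hd3 hL b₀ b₁, M₁ ≤ (geo9K i).M → ∀ α₀ : ℝ, 0 < α₀ → (geo9K i).M * α₀ ≤ a₁ →
      ∀ U : (bgT3 i).Cfg, (bgT3 i).Reg335 c35 α₀ U → (bgT3 i).Reg336 c35 α₀ U →
        Thm33G0 (𝔬 i) (R₀ i) (H₀ i) B₀ δ₀ U ∧
        Step (𝔬 i) (R₀ i) (H₀ i) (geoOK_geo9K i).lenle 1 (θ₁ * ((geo9K i).M * α₀)) δK U ∧
        Step (𝔬 i) (R₀ i) (H₀ i) (geoOK_geo9K i).lenle 2 (θ₁ * ((geo9K i).M * α₀)) δK U ∧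
        FormSmall (𝔬 i) (r₁ * ((geo9K i).M * α₀)) U ∧ Identities (𝔬 i) U)
    (hletters : ∀ i : KIdx 2 ℓ hd3 hL b₀ b₁, M₁ ≤ (geo9K i).M → ∀ α₀ : ℝ, 0 < α₀ → (geo9K i).M * α₀ ≤ a₁ →
      ∀ U : (bgT3 i).Cfg, (bgT3 i).Reg335 c35 α₀ U → (bgT3 i).Reg336 c35 α₀ U →
        Letters313 (𝔬 i) (R₀ i) (H₀ i) (geoOK_geo9K i) B₃ δ₃ U)
    (hres : ∀ i : KIdx 2 ℓ hd3 hL b₀ b₁, M₁ ≤ (geo9K i).M → ∀ α₀ : ℝ, 0 < α₀ → (geo9K i).M * α₀ ≤ a₁ →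
      ∀ U : (bgT3 i).Cfg, (bgT3 i).Reg335 c35 α₀ U → (bgT3 i).Reg336 c35 α₀ U →
        Clause342 (GG i) 1 B₁ δ₁ U ∧ L2Block (GG i) B₁ δ₁ U ∧
          (∀ (n : Fin 4) (lam : (geo9K i).Loc) (γ : ℝ), n ≠ 3 → -4 ≤ γ → γ ≤ 4 →
            (GG i).glob n U lam γ ≤ B₁ * (geo9K i).wNorm γ lam) ∧
          B9.Ineq343_345 (GG i) Bβ Bε Bεβ δ₁ U)
    (hpinE : ∀ i : KIdx 2 ℓ hd3 hL b₀ b₁, HasRWExp i = HasRWExpOfOps (𝔬 i)) (hpinK : ∀ i : KIdx 2 ℓ hd3 hL b₀ b₁, PosDefK i = PosDefKOfOps (𝔬 i)) :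
    B9.Thm313Printed c35 geo9K bgT3 GG HasRWExp PosDefK := by
  have hE : HasRWExp = fun i => HasRWExpOfOps (𝔬 i) := funext hpinE
  have hK : PosDefK = fun i => PosDefKOfOps (𝔬 i) := funext hpinK
  rw [hE, hK]
  obtain ⟨ML, c, hrow⟩ := rowSum261_geo9K (d := 2) (ℓ := ℓ) (hd := hd3) (hL := hL) (b₀ := b₀) (b₁ := b₁) σ hσ
  exact thm313Printed_of_step 𝔬 R₀ H₀ GG ev evY θ₁ r₁ B₀ δ₀ δK σ (max c 0) ρ a₁ M₁ ML B₁ δ₁ B₃ δ₃ ρ' Bβ Bε Bεβ hθ₁ hr₁ hB₀ hB₃ hσ.le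
    hρ' hρ'ρ hρS hρ₃ hρδ (le_max_right _ _) ha₁ hM₁ hB₁ hδ₁ hBβ hBε hBεβ (fun i => geoOK_geo9K i) (fun i => modelSignsOn_geo9K i)
    (fun i hM y => (hrow i hM y).trans (le_max_left _ _)) hco hmodel hletters hres

end Summit.QuantumFields.YangMills.Theorems.Prop7SectET3N06Leaves

end
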